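import Summits.BirchSwinnertonDyer.BirchSwinnertonDyer.Theorems.SignedLowerHalvesSprungLowerDivisibilityAtThreeColourTransfer
import Literature.NumberTheory.EllipticCurves.SkinnerUrban2014.CharacteristicIdealBaseChangeProofs
import Literature.NumberTheory.EllipticCurves.Kato2004.MainConjectureSkeletonProofs
import HarnessLib

/-!
# Crux K1 `SprungLowerDivisibilityAtThree` (stmt-BirchSwinnertonDyer-19875), line `chromatic-common-zeros` (skeleton v8),
# stub K_spor `stub_katoFineLowerSporadic`: the SPORADIC LEDGER — zeta index, local Coleman index, fine mass
# (`--supports` 19875 as helper; closes nothing; K_spor / K1 / leaf X8 / BSD are NOT proved here)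

Cell `bsd-ssimc`, width seat `cruxlead-…-19875-w2` (g7), executing `Cruxes/SprungLowerDivisibilityAtThree/
STUB-PLAN-stub_katoFineLowerSporadic.md` (stub-critic, 2026-08-28) §3 Rank 0 + α2 / k1-B: the CURRENCY in which every
plan for K_spor is written, as kernel theorems. Notation at a height-one prime `𝔭` of `Λ = ℤ_p⟦T⟧`, for ONE pinned
`I = 𝐇¹_Γ(T_pW)` with a ♯/♭ Coleman–Kato package `C` of colour `•` (Sprung 2012 Thm. 7.14 (3), tree structure
`Sprung2012.SharpFlatColemanKatoData`), `L^• ≠ 0`, Néron-normalised `G₁` (`ι G₁ = C(ϖ)·ι L^•`), dual data `D` of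
`Sel^•(E/ℚ_∞)` and `Y` of `Sel₀(ℚ_∞, E[p^∞])`:
`k = ℓ_𝔭(I.H ⧸ C.Z)` (ZETA INDEX), `c^• = ℓ_𝔭(Λ ⧸ range Col^•)` (LOCAL INDEX of the colour), `m^• = ℓ_𝔭 Λ/(G₁)`
(multiplicity of the zero of `L^•`), `x = ℓ_𝔭 Y.X` (FINE MASS). K_spor at `𝔭` reads `k ≤ x`.

* §0 `Λ`-bookkeeping off `(p)`: constants `C(a)`, `a ∈ ℤ_p ∖ 0`, lie in no height-one `𝔭 ∌ p`; `ℓ_𝔭 Λ/(C(a)·x) = ℓ_𝔭 Λ/(x)`;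
  the Néron normalisation is invisible off `(p)`: `ℓ_𝔭 Λ/(G₁) = ℓ_𝔭 Λ/(L^•) = ℓ_𝔭 Λ/(pⁿ L^•)`.
* §1 THE CONTENT IDENTITY `m^• = k + c^•` at EVERY height-one `𝔭` (package fields `image_zeta_localized` +
  `colMap_injective` only): `SharpFlatColemanKatoData.lengthAt_quotient_span_eq_zeta_add_range`; hence the ZETA-INDEX CAP
  `k ≤ m^•` (`…lengthAt_quotient_zeta_le_lengthAt_quotient_span`; and trivially `c^• ≤ m^•`).
* §2 KATO'S DIRECTION IN FINE CURRENCY, γ-keyed, off `(p)`: from the OUTPUT `∃ n, pⁿ L^• ∈ char X^•` of Sprung 2012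
  Thm. 7.16 (displayed hypothesis `hKato`, no Galois-image condition) `x ≤ k` (`…fine_le_zeta_of_pow_mul_mem_charIdeal`);
  so off `(p)`: `x ≤ k ≤ m^•` for every non-vanishing colour.
* §3 THE DEFECT ELEMENT: one `j ≠ 0` in `Λ` with `k = x + ℓ_𝔭 Λ/(j)` at every height-one `𝔭 ∌ p`
  (`…exists_zeta_eq_fine_add_defect`; `j = pⁿL^• / gen`, `char X^• = (gen)`), and `k ≤ x ⟺ j ∉ 𝔭`
  (`zeta_le_fine_iff_not_mem_of_eq_add`): K_spor at `𝔭` says «the defect misses `𝔭`», K1 ∧ Kato ⊆ say «`j ∈ Λˣ` off `(p)`».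
* §4 THE SIMPLE-ZERO DOOR: `m^• ≤ 1 ∧ (m^• = 0 ∨ 1 ≤ x) ⟹ k ≤ x` (`…fine_lower_of_lengthAt_quotient_span_le_one`) — at a
  simple zero of one colour K_spor is the SUPPORT statement `x ≥ 1`; the case `m^• = 0` is p613455's
  `lengthAt_quotient_zeta_eq_zero_of_not_mem`.
* The X8-pair forms in the stub's binder shape `h714 → h716 → h3 → …` live in the sibling file `…KatoSporadicLedgerX8`.

KEYING CAVEAT (STUB-PLAN §0bis): the stub's `Y : FineSelmerDualData κ γ` is γ-keyed (Kato's `X₀` composed with `ι` against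
the natural `I`), so `x = ℓ_𝔭 Y.X = ℓ_{ι𝔭} X₀^nat`; everything here is about the typed objects exactly as the skeleton binds
them and uses NO `Kato2004.thm13_4…` fact. HONEST FRAMING: these theorems fix the currency (doors + regime logic); they are
not progress on the residue `{k > j}`, which is Kato's Main Conjecture 12.10 (⊆) at the sporadic primes. The one CONDITIONAL
input is the displayed hypothesis `hKato` (= the output of `thm716_sharpFlatCharIdeal_divisibility`).

References: [Kato2004Asterisque] Conj. 12.10 (p. 224), Thm. 12.5/12.6 (p. 222), §17.13 (p. 280); [Sprung2012] Def. 6.1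
(p. 1495), Thm. 7.14 (3), Thm. 7.16 (p. 1504), Prop. 7.19 (p. 1505); [KuriharaPollack2007] §3 Problem 3.2, Props. 3.3–3.4
(the generator bookkeeping, there under (Ka)); [LeiSujatha2021] Thm. 1.2, (SES-KP), (PT); [Washington1997] §13.2;
tree: `…ColourTransfer` (p607724), `…KatoFineSporadic` (p613455), `…KatoFineLowerIff` (p617250), `…CharIdealLowerGlue`.
-/

set_option linter.dupNamespace false
set_option autoImplicit false

noncomputable section

open scoped Classical NumberField MatrixGroups ModularForm

open NumberField IsDedekindDomain CongruenceSubgroup WeierstrassCurve Field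
  Literature.NumberTheory.EllipticCurves Literature.NumberTheory.EllipticCurves.ModularForms
  Literature.NumberTheory.EllipticCurves.ZpExtension Literature.NumberTheory.EllipticCurves.Sprung2017
  Literature.NumberTheory.EllipticCurves.Sprung2012 Literature.NumberTheory.EllipticCurves.Kato2004
  Literature.NumberTheory.EllipticCurves.Module
  Summit.BirchSwinnertonDyer.BirchSwinnertonDyer.Theorems
  Summit.BirchSwinnertonDyer.BirchSwinnertonDyer.Theorems.SmallImageSignedMuDefect

namespace Summit.BirchSwinnertonDyer.BirchSwinnertonDyer.Theorems.ChromaticCommonZeros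

/-! ### §0 `Λ`-bookkeeping off `(p)` -/

section OffP

variable {p : ℕ} [Fact p.Prime]

/-- A non-zero constant `C(a)`, `a ∈ ℤ_p`, lies in no prime `𝔭` of `Λ` with `p ∉ 𝔭`: `a = u·p^v` with `u` a unit.
[folklore] -/
theorem C_not_mem_of_natCast_p_not_mem {a : ℤ_[p]} (ha : a ≠ 0) (𝔭 : PrimeSpectrum (IwasawaAlgebra p))
    (hp𝔭 : (p : IwasawaAlgebra p) ∉ 𝔭.asIdeal) : PowerSeries.C a ∉ 𝔭.asIdeal := by
  intro hmem
  have hspec := PadicInt.unitCoeff_spec ha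
  have hCa : (PowerSeries.C a : IwasawaAlgebra p) =
      PowerSeries.C ((PadicInt.unitCoeff ha : ℤ_[p])) * (p : IwasawaAlgebra p) ^ a.valuation := by
    conv_lhs => rw [hspec]
    rw [map_mul, map_pow, map_natCast]
  rw [hCa] at hmem
  rcases 𝔭.isPrime.mem_or_mem hmem with hu | hpow
  · have hunit : IsUnit (PowerSeries.C ((PadicInt.unitCoeff ha : ℤ_[p])) : IwasawaAlgebra p) :=
      (Units.isUnit _).map PowerSeries.C
    exact 𝔭.isPrime.ne_top (Ideal.eq_top_of_isUnit_mem _ hu hunit)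
  · exact hp𝔭 (𝔭.isPrime.mem_of_pow_mem _ hpow)

/-- Off `(p)` a non-zero constant factor does not change the local length of a cyclic quotient:
`ℓ_𝔭 Λ/(C(a)·x) = ℓ_𝔭 Λ/(x)` for `a ∈ ℤ_p ∖ 0`, `p ∉ 𝔭`. [folklore] -/
theorem lengthAt_quotient_span_C_mul_eq_of_natCast_p_not_mem {a : ℤ_[p]} (ha : a ≠ 0) (x : IwasawaAlgebra p)
    (𝔭 : PrimeSpectrum (IwasawaAlgebra p)) (hp𝔭 : (p : IwasawaAlgebra p) ∉ 𝔭.asIdeal) :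
    lengthAt (IwasawaAlgebra p) (IwasawaAlgebra p ⧸ Ideal.span {PowerSeries.C a * x}) 𝔭 =
      lengthAt (IwasawaAlgebra p) (IwasawaAlgebra p ⧸ Ideal.span {x}) 𝔭 := by
  have hCa0 : (PowerSeries.C a : IwasawaAlgebra p) ≠ 0 := by
    rw [Ne, ← map_zero (PowerSeries.C (R := ℤ_[p])), PowerSeries.C_injective.eq_iff]
    exact ha
  have hnot : ¬ Ideal.span {PowerSeries.C a} ≤ 𝔭.asIdeal := by
    rw [Ideal.span_singleton_le_iff_mem]
    exact C_not_mem_of_natCast_p_not_mem ha 𝔭 hp𝔭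
  rw [lengthAt_quotient_span_singleton_mul x hCa0 𝔭, lengthAt_quotient_eq_zero_of_not_le hnot, zero_add]

/-- Off `(p)` a `p`-power factor does not change the local length: `ℓ_𝔭 Λ/(pⁿ·x) = ℓ_𝔭 Λ/(x)` for `p ∉ 𝔭`.
[folklore] -/
theorem lengthAt_quotient_span_natCast_pow_mul_eq_of_not_mem (n : ℕ) (x : IwasawaAlgebra p)
    (𝔭 : PrimeSpectrum (IwasawaAlgebra p)) (hp𝔭 : (p : IwasawaAlgebra p) ∉ 𝔭.asIdeal) :
    lengthAt (IwasawaAlgebra p) (IwasawaAlgebra p ⧸ Ideal.span {(p : IwasawaAlgebra p) ^ n * x}) 𝔭 =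
      lengthAt (IwasawaAlgebra p) (IwasawaAlgebra p ⧸ Ideal.span {x}) 𝔭 := by
  have hpn : ((p : ℤ_[p]) ^ n) ≠ 0 := pow_ne_zero n (by exact_mod_cast (Fact.out : p.Prime).ne_zero)
  have hC : (p : IwasawaAlgebra p) ^ n = PowerSeries.C ((p : ℤ_[p]) ^ n) := by
    rw [map_pow, map_natCast]
  rw [hC]
  exact lengthAt_quotient_span_C_mul_eq_of_natCast_p_not_mem hpn x 𝔭 hp𝔭

/-- **The Néron normalisation is invisible off `(p)`.** If `ι G₁ = C(ϖ)·ι L` (`ι : Λ ↪ ℚ_p⟦T⟧`) with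
`ϖ ∈ ℚ ∖ 0`, then `ℓ_𝔭 Λ/(G₁) = ℓ_𝔭 Λ/(L)` at every prime `𝔭 ∌ p`: writing `ϖ = a/b`, `C(b)·G₁ = C(a)·L` in `Λ`.
[cite: Sprung2012, Def. 6.1 (p. 1495)] -/
theorem lengthAt_quotient_span_normalised_eq_of_natCast_p_not_mem {ϖ : ℚ} (hϖ : ϖ ≠ 0)
    {G₁ L : IwasawaAlgebra p}
    (hG₁ : iwasawaToPowerSeries p G₁ = PowerSeries.C ((ϖ : ℚ) : ℚ_[p]) * iwasawaToPowerSeries p L)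
    (𝔭 : PrimeSpectrum (IwasawaAlgebra p)) (hp𝔭 : (p : IwasawaAlgebra p) ∉ 𝔭.asIdeal) :
    lengthAt (IwasawaAlgebra p) (IwasawaAlgebra p ⧸ Ideal.span {G₁}) 𝔭 =
      lengthAt (IwasawaAlgebra p) (IwasawaAlgebra p ⧸ Ideal.span {L}) 𝔭 := by
  -- `C(den ϖ) · G₁ = C(num ϖ) · L` in `Λ`
  have hden : (ϖ.den : ℤ_[p]) ≠ 0 := by exact_mod_cast ϖ.den_nz
  have hnum : (ϖ.num : ℤ_[p]) ≠ 0 := by exact_mod_cast Rat.num_ne_zero.mpr hϖ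
  have hrat : (ϖ.den : ℚ_[p]) * ((ϖ : ℚ) : ℚ_[p]) = (ϖ.num : ℚ_[p]) := by
    have h := congrArg (fun q : ℚ => (q : ℚ_[p])) (Rat.den_mul_eq_num ϖ)
    push_cast at h
    exact h
  have hrat' : algebraMap ℤ_[p] ℚ_[p] (ϖ.den : ℤ_[p]) * ((ϖ : ℚ) : ℚ_[p]) =
      algebraMap ℤ_[p] ℚ_[p] (ϖ.num : ℤ_[p]) := by
    rwa [map_natCast, map_intCast]
  have hrel : PowerSeries.C (ϖ.den : ℤ_[p]) * G₁ = PowerSeries.C (ϖ.num : ℤ_[p]) * L := by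
    apply iwasawaToPowerSeries_injective p
    rw [map_mul, map_mul, hG₁, ← mul_assoc, PowerSeries.map_C, PowerSeries.map_C, ← map_mul, hrat']
  rw [← lengthAt_quotient_span_C_mul_eq_of_natCast_p_not_mem hden G₁ 𝔭 hp𝔭, hrel,
    lengthAt_quotient_span_C_mul_eq_of_natCast_p_not_mem hnum L 𝔭 hp𝔭]

/-- `ℓ_𝔭 Λ/(j) = 0 ⟺ j ∉ 𝔭` at a height-one prime (for any `j`; the quotient `Λ/(j) ↠ Λ/𝔭` has length `≥ 1`
when `j ∈ 𝔭`). [folklore] -/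
theorem lengthAt_quotient_span_eq_zero_iff_not_mem (j : IwasawaAlgebra p)
    (𝔭 : PrimeSpectrum (IwasawaAlgebra p)) :
    lengthAt (IwasawaAlgebra p) (IwasawaAlgebra p ⧸ Ideal.span {j}) 𝔭 = 0 ↔ j ∉ 𝔭.asIdeal := by
  constructor
  · intro h0 hj
    have hle : Ideal.span {j} ≤ 𝔭.asIdeal := by rwa [Ideal.span_singleton_le_iff_mem]
    have h1 : lengthAt (IwasawaAlgebra p) (IwasawaAlgebra p ⧸ 𝔭.asIdeal) 𝔭 ≤
        lengthAt (IwasawaAlgebra p) (IwasawaAlgebra p ⧸ Ideal.span {j}) 𝔭 :=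
      lengthAt_le_of_surjective (Submodule.factor hle) (Submodule.factor_surjective hle) 𝔭
    rw [lengthAt_quotient_self 𝔭, h0] at h1
    exact one_ne_zero (le_antisymm h1 bot_le)
  · intro hj
    exact lengthAt_quotient_eq_zero_of_not_le (by rwa [Ideal.span_singleton_le_iff_mem])

/-- **`k ≤ x ⟺ j ∉ 𝔭`** from a defect identity `k = x + ℓ_𝔭 Λ/(j)` with `k` finite (pure bookkeeping in `ℕ∞`).
[folklore] -/
theorem zeta_le_fine_iff_not_mem_of_eq_add {k x : ℕ∞} (hk : k ≠ ⊤) {j : IwasawaAlgebra p}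
    (𝔭 : PrimeSpectrum (IwasawaAlgebra p))
    (hdef : k = x + lengthAt (IwasawaAlgebra p) (IwasawaAlgebra p ⧸ Ideal.span {j}) 𝔭) :
    k ≤ x ↔ j ∉ 𝔭.asIdeal := by
  rw [← lengthAt_quotient_span_eq_zero_iff_not_mem j 𝔭]
  have hx : x ≠ ⊤ := by
    intro hx; rw [hx, top_add] at hdef; exact hk hdef
  constructor
  · intro hkx
    have h : x + lengthAt (IwasawaAlgebra p) (IwasawaAlgebra p ⧸ Ideal.span {j}) 𝔭 ≤ x + 0 := by
      rw [add_zero, ← hdef]; exact hkx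
    exact le_antisymm ((ENat.addLECancellable_of_ne_top hx).add_le_add_iff_left.mp h) bot_le
  · intro h0
    rw [hdef, h0, add_zero]

end OffP

/-! ### §1 The content identity `m^• = k + c^•` and the zeta-index cap `k ≤ m^•` -/

section Package

variable (W : WeierstrassCurve ℚ) [W.IsElliptic] (p : ℕ) [Fact p.Prime]
  [ContinuousSMul ℤ_[p] (W.tateModule p)] [Module.Free ℤ_[p] (W.tateModule p)]
  [Module.Finite ℤ_[p] (W.tateModule p)]
  {N : ℕ} {f : CuspForm (Gamma0 N) 2} {ϖ : ℚ} {κ : ZpExtension ℚ p} {γ : absoluteGaloisGroup ℚ}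
  {E : Type} [Field E] [Algebra ℚ E] {ι : AlgebraicClosure ℚ →ₐ[ℚ] AlgebraicClosure E} {ap : ℤ}
  {g : absoluteGaloisGroup E} {c : ℕ → localPoints W E} {I : IwasawaH1Data W p κ γ}

/-- **THE CONTENT IDENTITY `m^• = k + c^•` at every height-one prime.** For a ♯/♭ Coleman–Kato package `C` of colour
`•` with `L^• ≠ 0` (so `Col^•` is injective on `𝐇¹`), `E[p]` irreducible and Néron-normalised `G₁`:
`ℓ_𝔭 Λ/(G₁) = ℓ_𝔭(𝐇¹/Z) + ℓ_𝔭(Λ ⧸ range Col^•)` — the ideals `Col^•(Z)` and `(G₁)` agree after localisation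
(`image_zeta_localized`), and `𝐇¹ ↪ Λ` has `Λ/Col(Z)` an extension of `Λ/Col(𝐇¹)` by `𝐇¹/Z`. (Kurihara–Pollack's generator
bookkeeping, run WITHOUT their hypothesis (Ka).) [cite: Sprung2012, Def. 6.1 (p. 1495), Thm. 7.14 (3) (p. 1504)]
[cite: Kato2004Asterisque, Thm. 12.6 (p. 222), §17.13 (p. 280)] [cite: KuriharaPollack2007, Prop. 3.4] -/
theorem _root_.Literature.NumberTheory.EllipticCurves.Sprung2012.SharpFlatColemanKatoData.lengthAt_quotient_span_eq_zeta_add_range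
    {col : Chroma} (C : SharpFlatColemanKatoData W p f ϖ κ γ ι ap g c col I)
    (hirr : W.HasIrreducibleModPGaloisRep p) {Lsharp Lflat G₁ : IwasawaAlgebra p}
    (hSP : IsSprungPair f p ap Lsharp Lflat) (hcol : chromaticL col Lsharp Lflat ≠ 0)
    (hG₁ : iwasawaToPowerSeries p G₁ =
      PowerSeries.C ((ϖ : ℚ) : ℚ_[p]) * iwasawaToPowerSeries p (chromaticL col Lsharp Lflat))
    (𝔭 : PrimeSpectrum (IwasawaAlgebra p)) (h𝔭 : 𝔭.asIdeal.height = 1) :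
    lengthAt (IwasawaAlgebra p) (IwasawaAlgebra p ⧸ Ideal.span {G₁}) 𝔭 =
      lengthAt (IwasawaAlgebra p) (I.H ⧸ C.Z) 𝔭 +
        lengthAt (IwasawaAlgebra p) (IwasawaAlgebra p ⧸ LinearMap.range C.colMap) 𝔭 := by
  obtain ⟨s, hs, hsG, hZG⟩ := C.image_zeta_localized hirr Lsharp Lflat G₁ hSP hG₁ 𝔭 h𝔭
  have hMG : lengthAt (IwasawaAlgebra p) (IwasawaAlgebra p ⧸ Submodule.map C.colMap C.Z) 𝔭 =
      lengthAt (IwasawaAlgebra p) (IwasawaAlgebra p ⧸ Ideal.span {G₁}) 𝔭 := by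
    refine lengthAt_quotient_eq_of_smul_mem (Submodule.map C.colMap C.Z) (Ideal.span {G₁}) 𝔭 hs ?_ ?_
    · intro x hx
      obtain ⟨a, rfl⟩ := Ideal.mem_span_singleton'.mp hx
      rw [smul_eq_mul, ← mul_assoc, mul_comm s a, mul_assoc]
      exact Ideal.mul_mem_left _ a hsG
    · rintro _ ⟨z, hz, rfl⟩
      rw [smul_eq_mul]
      exact hZG z hz
  rw [← hMG, lengthAt_quotient_map_eq_add C.colMap (C.colMap_injective Lsharp Lflat hSP hcol) C.Z 𝔭]

/-- **ZETA-INDEX CAP `k ≤ m^•`: the zeta index is at most the multiplicity of the zero of EVERY non-vanishing colour.**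
`ℓ_𝔭(𝐇¹/Z) ≤ ℓ_𝔭 Λ/(G₁)` at every height-one `𝔭` (also at `(p)`). The case `G₁ ∉ 𝔭` is
`lengthAt_quotient_zeta_eq_zero_of_not_mem`; at a SIMPLE zero of `L^•` it gives `k ≤ 1`.
[cite: Sprung2012, Thm. 7.14 (3) (p. 1504)] [cite: Kato2004Asterisque, Thm. 12.5 (p. 222)] -/
theorem _root_.Literature.NumberTheory.EllipticCurves.Sprung2012.SharpFlatColemanKatoData.lengthAt_quotient_zeta_le_lengthAt_quotient_span
    {col : Chroma} (C : SharpFlatColemanKatoData W p f ϖ κ γ ι ap g c col I)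
    (hirr : W.HasIrreducibleModPGaloisRep p) {Lsharp Lflat G₁ : IwasawaAlgebra p}
    (hSP : IsSprungPair f p ap Lsharp Lflat) (hcol : chromaticL col Lsharp Lflat ≠ 0)
    (hG₁ : iwasawaToPowerSeries p G₁ =
      PowerSeries.C ((ϖ : ℚ) : ℚ_[p]) * iwasawaToPowerSeries p (chromaticL col Lsharp Lflat))
    (𝔭 : PrimeSpectrum (IwasawaAlgebra p)) (h𝔭 : 𝔭.asIdeal.height = 1) :
    lengthAt (IwasawaAlgebra p) (I.H ⧸ C.Z) 𝔭 ≤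
      lengthAt (IwasawaAlgebra p) (IwasawaAlgebra p ⧸ Ideal.span {G₁}) 𝔭 := by
  rw [C.lengthAt_quotient_span_eq_zeta_add_range W p hirr hSP hcol hG₁ 𝔭 h𝔭]
  exact le_self_add

/-! ### §2 Kato's direction in fine currency, γ-keyed, off `(p)`: `x ≤ k` from the output of Thm. 7.16 -/

/-- **`ℓ_𝔭 X₀ ≤ ℓ_𝔭(𝐇¹/Z)` off `(p)`, from `pⁿ L^• ∈ char X^•`.** Package `C` of colour `•`, `L^• ≠ 0`, `E[p]` irreducible,
Néron-normalised `G₁ ≠ 0`, a finitely generated torsion dual datum `D` of `Sel^•(E/ℚ_∞)` carrying the OUTPUT of Sprung 2012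
Thm. 7.16 (`hKato : ∃ n, pⁿ·L^• ∈ D.charIdeal`; Kato's Thm. 12.5 in ♯/♭ currency), any fine dual datum `Y`, and a
height-one `𝔭 ∌ p`: then `ℓ_𝔭 Y.X ≤ ℓ_𝔭(I.H ⧸ C.Z)`. Route: `ℓ_𝔭 X^• ≤ ℓ_𝔭 Λ/(pⁿL^•) = ℓ_𝔭 Λ/(G₁)` (char determines
height-one lengths; constants invisible off `(p)`), then the four-term identity `ℓ X^• + ℓ(𝐇¹/Z) = ℓ X₀ + ℓ Λ/(G₁)`.
γ-KEYED (`Y` as typed); no `Kato2004.thm13_4…` fact is used. [cite: Sprung2012, Thm. 7.16 (p. 1504), Prop. 7.19 (p. 1505)]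
[cite: Kato2004Asterisque, Thm. 12.5 (p. 222), §17.13 (p. 280)] [cite: SkinnerUrban2014, §3.1.6 (p. 20)] -/
theorem _root_.Literature.NumberTheory.EllipticCurves.Sprung2012.SharpFlatColemanKatoData.fine_le_zeta_of_pow_mul_mem_charIdeal
    {col : Chroma} (C : SharpFlatColemanKatoData W p f ϖ κ γ ι ap g c col I)
    (hirr : W.HasIrreducibleModPGaloisRep p) {Lsharp Lflat G₁ : IwasawaAlgebra p}
    (hSP : IsSprungPair f p ap Lsharp Lflat) (hcol : chromaticL col Lsharp Lflat ≠ 0)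
    (hG₁ : iwasawaToPowerSeries p G₁ =
      PowerSeries.C ((ϖ : ℚ) : ℚ_[p]) * iwasawaToPowerSeries p (chromaticL col Lsharp Lflat))
    (hG0 : G₁ ≠ 0)
    (D : SharpFlatSelmerDualData W κ γ ι ap g c col) [Module.Finite (IwasawaAlgebra p) D.X]
    (hXt : Module.IsTorsion (IwasawaAlgebra p) D.X) (Y : W.FineSelmerDualData κ γ)
    (hKato : ∃ n : ℕ, (p : IwasawaAlgebra p) ^ n * chromaticL col Lsharp Lflat ∈ D.charIdeal)
    (𝔭 : PrimeSpectrum (IwasawaAlgebra p)) (h𝔭 : 𝔭.asIdeal.height = 1)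
    (hp𝔭 : (p : IwasawaAlgebra p) ∉ 𝔭.asIdeal) :
    lengthAt (IwasawaAlgebra p) Y.X 𝔭 ≤ lengthAt (IwasawaAlgebra p) (I.H ⧸ C.Z) 𝔭 := by
  obtain ⟨n, hn⟩ := hKato
  have hϖ : ϖ ≠ 0 := by
    rintro rfl
    apply hG0
    apply iwasawaToPowerSeries_injective p
    rw [hG₁, Rat.cast_zero, map_zero, zero_mul, map_zero]
  have hpΛ : (p : IwasawaAlgebra p) ≠ 0 := by
    rw [← map_natCast (PowerSeries.C (R := ℤ_[p])) p]
    exact (IwasawaAlgebra.prime_C p).ne_zero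
  have hx0 : (p : IwasawaAlgebra p) ^ n * chromaticL col Lsharp Lflat ≠ 0 :=
    mul_ne_zero (pow_ne_zero n hpΛ) hcol
  -- `ℓ_𝔭 X^• ≤ ℓ_𝔭 Λ/(pⁿ L^•)`: the characteristic ideal determines the height-one lengths
  have h1 : lengthAt (IwasawaAlgebra p) D.X 𝔭 ≤
      lengthAt (IwasawaAlgebra p) (IwasawaAlgebra p ⧸ Ideal.span {(p : IwasawaAlgebra p) ^ n * chromaticL col Lsharp Lflat}) 𝔭 := by
    have hby := isTorsionBy_quotient_span_singleton (R := IwasawaAlgebra p)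
      ((p : IwasawaAlgebra p) ^ n * chromaticL col Lsharp Lflat)
    refine SkinnerUrban2014.lengthAt_le_of_charIdeal_le
      (M := IwasawaAlgebra p ⧸ Ideal.span {(p : IwasawaAlgebra p) ^ n * chromaticL col Lsharp Lflat}) (N := D.X)
      (fun y ↦ ⟨⟨_, mem_nonZeroDivisors_of_ne_zero hx0⟩, @hby y⟩) hXt ?_ 𝔭 h𝔭
    rw [Module.charIdeal_eq_span_of_lengthAt_eq_quotient hx0 fun _ _ ↦ rfl, Ideal.span_singleton_le_iff_mem]
    exact hn
  -- `ℓ_𝔭 Λ/(pⁿ L^•) = ℓ_𝔭 Λ/(L^•) = ℓ_𝔭 Λ/(G₁)` off `(p)`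
  rw [lengthAt_quotient_span_natCast_pow_mul_eq_of_not_mem n (chromaticL col Lsharp Lflat) 𝔭 hp𝔭,
    ← lengthAt_quotient_span_normalised_eq_of_natCast_p_not_mem hϖ hG₁ 𝔭 hp𝔭] at h1
  -- flip through the four-term identity
  have h4 := C.lengthAt_add_eq W p hirr hSP hcol hG₁ D Y 𝔭 h𝔭
  have hd : lengthAt (IwasawaAlgebra p) (IwasawaAlgebra p ⧸ Ideal.span {G₁}) 𝔭 ≠ ⊤ :=
    lengthAt_ne_top_of_isTorsionBy hG0 (isTorsionBy_quotient_span_singleton G₁) 𝔭 (le_of_eq h𝔭)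
  have key : lengthAt (IwasawaAlgebra p) Y.X 𝔭 +
        lengthAt (IwasawaAlgebra p) (IwasawaAlgebra p ⧸ Ideal.span {G₁}) 𝔭 ≤
      lengthAt (IwasawaAlgebra p) (I.H ⧸ C.Z) 𝔭 +
        lengthAt (IwasawaAlgebra p) (IwasawaAlgebra p ⧸ Ideal.span {G₁}) 𝔭 := by
    calc lengthAt (IwasawaAlgebra p) Y.X 𝔭 +
          lengthAt (IwasawaAlgebra p) (IwasawaAlgebra p ⧸ Ideal.span {G₁}) 𝔭
        = lengthAt (IwasawaAlgebra p) D.X 𝔭 + lengthAt (IwasawaAlgebra p) (I.H ⧸ C.Z) 𝔭 := h4.symm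
      _ ≤ lengthAt (IwasawaAlgebra p) (IwasawaAlgebra p ⧸ Ideal.span {G₁}) 𝔭 +
          lengthAt (IwasawaAlgebra p) (I.H ⧸ C.Z) 𝔭 := add_le_add h1 le_rfl
      _ = _ := add_comm _ _
  exact (ENat.addLECancellable_of_ne_top hd).add_le_add_iff_right.mp key

/-! ### §3 The defect element `j`: `k = x + ℓ_𝔭 Λ/(j)` off `(p)`, and `k ≤ x ⟺ j ∉ 𝔭` -/

/-- **THE DEFECT ELEMENT.** Same data as `fine_le_zeta_of_pow_mul_mem_charIdeal`: there is ONE `j ≠ 0` in `Λ` (namely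
`j = pⁿL^•/gen` for a generator `gen` of `char X^•`) such that at every height-one `𝔭 ∌ p`:
`ℓ_𝔭(𝐇¹/Z) = ℓ_𝔭 Y.X + ℓ_𝔭 Λ/(j)`. So K_spor at `𝔭` ⟺ `j ∉ 𝔭` (`zeta_le_fine_iff_not_mem_of_eq_add`), while
`K1 ∧ (Kato ⊆)` for the colour say `j` is a unit off `(p)`. [cite: Sprung2012, Thm. 7.16 (p. 1504), Prop. 7.19 (p. 1505)]
[cite: Kato2004Asterisque, Conj. 12.10 (p. 224), §17.13 (p. 280)] [cite: Washington1997, §13.2] -/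
theorem _root_.Literature.NumberTheory.EllipticCurves.Sprung2012.SharpFlatColemanKatoData.exists_zeta_eq_fine_add_defect
    {col : Chroma} (C : SharpFlatColemanKatoData W p f ϖ κ γ ι ap g c col I)
    (hirr : W.HasIrreducibleModPGaloisRep p) {Lsharp Lflat G₁ : IwasawaAlgebra p}
    (hSP : IsSprungPair f p ap Lsharp Lflat) (hcol : chromaticL col Lsharp Lflat ≠ 0)
    (hG₁ : iwasawaToPowerSeries p G₁ =
      PowerSeries.C ((ϖ : ℚ) : ℚ_[p]) * iwasawaToPowerSeries p (chromaticL col Lsharp Lflat))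
    (hG0 : G₁ ≠ 0)
    (D : SharpFlatSelmerDualData W κ γ ι ap g c col) [Module.Finite (IwasawaAlgebra p) D.X]
    (hXt : Module.IsTorsion (IwasawaAlgebra p) D.X)
    (hKato : ∃ n : ℕ, (p : IwasawaAlgebra p) ^ n * chromaticL col Lsharp Lflat ∈ D.charIdeal) :
    ∃ j : IwasawaAlgebra p, j ≠ 0 ∧
      ∀ (Y : W.FineSelmerDualData κ γ) (𝔭 : PrimeSpectrum (IwasawaAlgebra p)), 𝔭.asIdeal.height = 1 →
        (p : IwasawaAlgebra p) ∉ 𝔭.asIdeal →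
        lengthAt (IwasawaAlgebra p) (I.H ⧸ C.Z) 𝔭 =
          lengthAt (IwasawaAlgebra p) Y.X 𝔭 +
            lengthAt (IwasawaAlgebra p) (IwasawaAlgebra p ⧸ Ideal.span {j}) 𝔭 := by
  obtain ⟨n, hn⟩ := hKato
  have hϖ : ϖ ≠ 0 := by
    rintro rfl
    apply hG0
    apply iwasawaToPowerSeries_injective p
    rw [hG₁, Rat.cast_zero, map_zero, zero_mul, map_zero]
  have hpΛ : (p : IwasawaAlgebra p) ≠ 0 := by
    rw [← map_natCast (PowerSeries.C (R := ℤ_[p])) p]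
    exact (IwasawaAlgebra.prime_C p).ne_zero
  have hx0 : (p : IwasawaAlgebra p) ^ n * chromaticL col Lsharp Lflat ≠ 0 :=
    mul_ne_zero (pow_ne_zero n hpΛ) hcol
  -- `char X^• = (gen)`, `pⁿ L^• = gen · j`
  obtain ⟨gen, hgen⟩ := (charIdeal_isPrincipal_holds p D.X : (Module.charIdeal (IwasawaAlgebra p) D.X).IsPrincipal)
  have hgen' : Module.charIdeal (IwasawaAlgebra p) D.X = Ideal.span {gen} := hgen
  have hn' : (p : IwasawaAlgebra p) ^ n * chromaticL col Lsharp Lflat ∈ Ideal.span {gen} := by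
    rw [← hgen']; exact hn
  obtain ⟨j, hj⟩ := Ideal.mem_span_singleton'.mp hn'
  -- hj : j * gen = p ^ n * L
  have hgen0 : gen ≠ 0 := by
    rintro rfl; rw [mul_zero] at hj; exact hx0 hj.symm
  have hj0 : j ≠ 0 := by
    rintro rfl; rw [zero_mul] at hj; exact hx0 hj.symm
  refine ⟨j, hj0, fun Y 𝔭 h𝔭 hp𝔭 => ?_⟩
  -- `ℓ_𝔭 X^• = ℓ_𝔭 Λ/(gen)`
  have hXgen : lengthAt (IwasawaAlgebra p) D.X 𝔭 =
      lengthAt (IwasawaAlgebra p) (IwasawaAlgebra p ⧸ Ideal.span {gen}) 𝔭 := by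
    have hby := isTorsionBy_quotient_span_singleton (R := IwasawaAlgebra p) gen
    refine SkinnerUrban2014.lengthAt_eq_of_charIdeal_eq hXt
      (fun y ↦ ⟨⟨gen, mem_nonZeroDivisors_of_ne_zero hgen0⟩, @hby y⟩) ?_ 𝔭 h𝔭
    rw [hgen', Module.charIdeal_eq_span_of_lengthAt_eq_quotient hgen0 fun _ _ ↦ rfl]
  -- `ℓ_𝔭 Λ/(G₁) = ℓ_𝔭 Λ/(pⁿ L^•) = ℓ_𝔭 Λ/(gen) + ℓ_𝔭 Λ/(j)` off `(p)`
  have hm : lengthAt (IwasawaAlgebra p) (IwasawaAlgebra p ⧸ Ideal.span {G₁}) 𝔭 =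
      lengthAt (IwasawaAlgebra p) D.X 𝔭 +
        lengthAt (IwasawaAlgebra p) (IwasawaAlgebra p ⧸ Ideal.span {j}) 𝔭 := by
    rw [lengthAt_quotient_span_normalised_eq_of_natCast_p_not_mem hϖ hG₁ 𝔭 hp𝔭,
      ← lengthAt_quotient_span_natCast_pow_mul_eq_of_not_mem n (chromaticL col Lsharp Lflat) 𝔭 hp𝔭, ← hj,
      mul_comm j gen,
      lengthAt_quotient_span_singleton_mul j hgen0 𝔭, hXgen]
  -- the four-term identity, then cancel the finite `ℓ_𝔭 X^•`
  have h4 := C.lengthAt_add_eq W p hirr hSP hcol hG₁ D Y 𝔭 h𝔭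
  obtain ⟨t, htann, ht0⟩ := Submodule.annihilator_top_inter_nonZeroDivisors hXt
  have htX : Module.IsTorsionBy (IwasawaAlgebra p) D.X t := fun x =>
    Submodule.mem_annihilator.mp htann x Submodule.mem_top
  have ha : lengthAt (IwasawaAlgebra p) D.X 𝔭 ≠ ⊤ :=
    lengthAt_ne_top_of_isTorsionBy (nonZeroDivisors.ne_zero ht0) htX 𝔭 (le_of_eq h𝔭)
  rw [hm, ← add_assoc, add_comm (lengthAt (IwasawaAlgebra p) Y.X 𝔭), add_assoc] at h4
  exact (ENat.addLECancellable_of_ne_top ha).inj.mp h4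

/-! ### §4 The simple-zero door -/

/-- **THE SIMPLE-ZERO DOOR.** If ONE non-vanishing colour has `m^• = ℓ_𝔭 Λ/(G₁) ≤ 1` at the height-one prime `𝔭` (a
simple zero of `L^•`, or none), then Kato's fine inequality `ℓ_𝔭(𝐇¹/Z) ≤ ℓ_𝔭 Y.X` at `𝔭` follows from the SUPPORT
statement «`m^• = 0` or `ℓ_𝔭 Y.X ≥ 1`» (zeta-index cap `k ≤ m^• ≤ 1`). At a simple sporadic common zero this is exactly what
K_spor asks: one fine class at a non-classical point. [cite: Kato2004Asterisque, Conj. 12.10 (p. 224)]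
[cite: Sprung2012, Thm. 7.14 (3) (p. 1504)] -/
theorem _root_.Literature.NumberTheory.EllipticCurves.Sprung2012.SharpFlatColemanKatoData.fine_lower_of_lengthAt_quotient_span_le_one
    {col : Chroma} (C : SharpFlatColemanKatoData W p f ϖ κ γ ι ap g c col I)
    (hirr : W.HasIrreducibleModPGaloisRep p) {Lsharp Lflat G₁ : IwasawaAlgebra p}
    (hSP : IsSprungPair f p ap Lsharp Lflat) (hcol : chromaticL col Lsharp Lflat ≠ 0)
    (hG₁ : iwasawaToPowerSeries p G₁ =
      PowerSeries.C ((ϖ : ℚ) : ℚ_[p]) * iwasawaToPowerSeries p (chromaticL col Lsharp Lflat))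
    (Y : W.FineSelmerDualData κ γ) (𝔭 : PrimeSpectrum (IwasawaAlgebra p)) (h𝔭 : 𝔭.asIdeal.height = 1)
    (hsimple : lengthAt (IwasawaAlgebra p) (IwasawaAlgebra p ⧸ Ideal.span {G₁}) 𝔭 ≤ 1)
    (hsupp : lengthAt (IwasawaAlgebra p) (IwasawaAlgebra p ⧸ Ideal.span {G₁}) 𝔭 = 0 ∨
      1 ≤ lengthAt (IwasawaAlgebra p) Y.X 𝔭) :
    lengthAt (IwasawaAlgebra p) (I.H ⧸ C.Z) 𝔭 ≤ lengthAt (IwasawaAlgebra p) Y.X 𝔭 := by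
  have hk := C.lengthAt_quotient_zeta_le_lengthAt_quotient_span W p hirr hSP hcol hG₁ 𝔭 h𝔭
  rcases hsupp with h0 | h1
  · rw [h0] at hk
    exact hk.trans bot_le
  · exact (hk.trans hsimple).trans h1

end Package

end Summit.BirchSwinnertonDyer.BirchSwinnertonDyer.Theorems.ChromaticCommonZeros

end
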